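import Literature.Analysis.FluidPDE.CarlemanCalculus
import HarnessLib

/-!
# The first Carleman inequality of Escauriaza–Seregin–Šverák (Seregin 2014, App. A, Prop. 1.2)

Analysis/FluidPDE file in the backward-uniqueness track of the decomposition of **ns.S08**
`Literature.Analysis.FluidPDE.ess_endpoint` (Escauriaza–Seregin–Šverák 2003, Thm. 1.3 ⇐ Thm. 1.4
⇐ Thm. 5.1 (backward uniqueness across a half-space) and Thm. 4.1 (unique continuation), both
resting on two Carleman-type inequalities, ESS 2003 §6 = Seregin 2014, App. A.1). This file
proves the **`L₂` core of the first Carleman inequality** (Seregin 2014, Prop. 1.2, (A.1.1)):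
for the explicit weight `φ(x,t) = -|x|²/(8t) - (a+1) log h(t)`, `h(t) = t e^{(1-t)/3}`, and
`v = e^φ u`, the conjugated backward heat operator satisfies `t e^φ (∂ₜu + Δu) = P v` with
`P = S + A`,
`S v = tΔv + r_a v`, `r_a = -|x|²/(16t) + (a+1)(1 - t/3) - ½` (symmetric part, (A.1.3)),
`A v = t∂ₜv + ½(x·∇)v + (½ + n/4) v` (antisymmetric part, (A.1.4)),
and for every smooth `v` compactly supported in `{δ ≤ t ≤ 2}`, `δ > 0`:

* `two_mul_integral_inner_opS_opA` — the commutator identity (A.1.5)–(A.1.7):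
  `2 ∫ ⟪S v, A v⟫ = ((a+1)/3) ∫ t|v|²` (the "simple calculations" behind (A.1.6), carried out
  with the integration-by-parts identities of `FluidPDE/CarlemanCalculus`);
* `integral_mul_norm_sq_le_three_mul` — `(a+1) ∫ t|v|² ≤ 3 ∫ |P v|²` (as `∫|Pv|² ≥ 2∫⟪Sv, Av⟫`);
* `integral_mul_inner_opP` — (A.1.9): `∫ t⟪v, Pv⟫ = -∫ t²|∇v|² + ∫ t r_a|v|² - ½ ∫ t|v|²`;
* `integral_gradSq_add_le_four_mul` — (A.1.10) with `b₁ = 4`: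
  `∫ t²|∇v|² + ∫ (|x|²/16)|v|² ≤ 4 ∫ |P v|²` (`a + 1 ≥ 0`).

The translation back to `u` ((A.1.11), giving (A.1.1) with an absolute constant) is the object
of the sequel. All statements are proved.

## References

* G. Seregin, *Lecture notes on regularity theory for the Navier–Stokes equations*, World
  Scientific 2014, Appendix A.1, Prop. 1.2, (A.1.1)–(A.1.11).
* L. Escauriaza, G. Seregin, V. Šverák, *`L_{3,∞}`-solutions of Navier–Stokes equations and
  backward uniqueness*, Russ. Math. Surveys 58:2 (2003), §6.
* L. Hörmander, *Linear partial differential operators*, Springer 1963, §8.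
-/

noncomputable section

open MeasureTheory Set Function Filter Topology
open scoped InnerProductSpace RealInnerProductSpace

namespace Literature.Analysis.FluidPDE

namespace Carleman

/-! ### The conjugated operator: symmetric and antisymmetric parts (Seregin 2014, (A.1.2)–(A.1.4)) -/

section Core

variable {E : Type*} [NormedAddCommGroup E] [InnerProductSpace ℝ E] [FiniteDimensional ℝ E]
  [MeasurableSpace E] [BorelSpace E]
variable {F : Type*} [NormedAddCommGroup F] [InnerProductSpace ℝ F]

/-- The time part `g_a(t) = (a + 1)(1 - t/3) - 1/2` of the zeroth-order coefficient of the
symmetric part `S` for the weight `φ = -|x|²/(8t) - (a+1) log h(t)`, `h(t) = t e^{(1-t)/3}`: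
`t(|∇φ|² - ∂ₜφ) - 1/2 = -|x|²/(16t) + (a+1) t h'/h - 1/2` with `t h'(t)/h(t) = 1 - t/3`
(Seregin 2014, (A.1.3), (A.1.7)). [cite: Seregin2014, App. A.1 (A.1.3)] -/
def gS (a t : ℝ) : ℝ :=
  (a + 1) * (1 - t / 3) - 1 / 2

/-- The zeroth-order coefficient `r_a(t, x) = -|x|²/(16t) + g_a(t)` of the symmetric part
`S v = tΔv + r_a v` (Seregin 2014, (A.1.3) with the explicit weight `φ`). [cite: Seregin2014, App. A.1 (A.1.3)] -/
def rW (a : ℝ) (z : ℝ × E) : ℝ :=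
  -‖z.2‖ ^ 2 / (16 * z.1) + gS a z.1

/-- The symmetric part `S v = t(Δv + (|∇φ|² - ∂ₜφ) v) - v/2 = tΔₓv + r_a v` of `tL`
(Seregin 2014, (A.1.3)). [cite: Seregin2014, App. A.1 (A.1.3)] -/
def opS (a : ℝ) (V : ℝ × E → F) (z : ℝ × E) : F :=
  z.1 • lap V z + rW a z • V z

/-- The antisymmetric part `A v = ½(∂ₜ(tv) + t∂ₜv) - t(div(v ⊗ ∇φ) + ∇v∇φ)
= t∂ₜv + ½(x·∇)v + (1/2 + n/4) v` of `tL` for `∇φ = -x/(4t)` (Seregin 2014, (A.1.4)). [cite: Seregin2014, App. A.1 (A.1.4)] -/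
def opA (V : ℝ × E → F) (z : ℝ × E) : F :=
  z.1 • dt V z + (1 / 2 : ℝ) • xdx V z + (1 / 2 + (Module.finrank ℝ E : ℝ) / 4) • V z

/-- `P = S + A = tL`, `L v = e^φ (∂ₜ + Δ)(e^{-φ} v)` the conjugated backward heat operator
(Seregin 2014, (A.1.2)). [cite: Seregin2014, App. A.1 (A.1.2)] -/
def opP (a : ℝ) (V : ℝ × E → F) (z : ℝ × E) : F :=
  opS a V z + opA V z

/-! #### The scalar weights and their derivatives -/

omit [FiniteDimensional ℝ E] [MeasurableSpace E] [BorelSpace E] in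
/-- Derivative of a time-only weight at a point of differentiability:
`D(g ∘ t)(z) v = g'(t) v.1`. [folklore] -/
theorem fderiv_comp_fst_apply' {g : ℝ → ℝ} {z : ℝ × E} (hg : DifferentiableAt ℝ g z.1)
    (v : ℝ × E) : fderiv ℝ (fun y : ℝ × E => g y.1) z v = deriv g z.1 * v.1 := by
  have h : HasFDerivAt (fun y : ℝ × E => g y.1)
      (((1 : ℝ →L[ℝ] ℝ).smulRight (deriv g z.1)).comp (ContinuousLinearMap.fst ℝ ℝ E)) z :=
    hg.hasDerivAt.hasFDerivAt.comp z hasFDerivAt_fst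
  rw [h.fderiv]
  simp [mul_comm]

omit [FiniteDimensional ℝ E] [MeasurableSpace E] [BorelSpace E] in
/-- `z ↦ ‖x‖²` has derivative `v ↦ 2⟪x, v.2⟫`. [folklore] -/
theorem hasFDerivAt_norm_sq_snd (z : ℝ × E) :
    HasFDerivAt (fun y : ℝ × E => ‖y.2‖ ^ 2)
      ((2 • (innerSL ℝ (id z.2)).comp (ContinuousLinearMap.id ℝ E)).comp
        (ContinuousLinearMap.snd ℝ ℝ E)) z :=
  (hasFDerivAt_id (𝕜 := ℝ) z.2).norm_sq.comp z hasFDerivAt_snd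

omit [FiniteDimensional ℝ E] [MeasurableSpace E] [BorelSpace E] in
/-- Derivative of `z ↦ ‖x‖²` along `v = (s, e)`: `2⟪x, e⟫`. [folklore] -/
theorem fderiv_norm_sq_snd_apply (z v : ℝ × E) :
    fderiv ℝ (fun y : ℝ × E => ‖y.2‖ ^ 2) z v = 2 * ⟪z.2, v.2⟫ := by
  rw [(hasFDerivAt_norm_sq_snd z).fderiv]
  simp [innerSL_apply_apply]

omit [FiniteDimensional ℝ E] [MeasurableSpace E] [BorelSpace E] in
/-- `z ↦ ‖x‖²` is smooth. [folklore] -/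
theorem contDiff_norm_sq_snd {n : WithTop ℕ∞} : ContDiff ℝ n fun y : ℝ × E => ‖y.2‖ ^ 2 :=
  contDiff_snd.norm_sq ℝ

/-- `g_a'(t) = -(a+1)/3`. [folklore] -/
theorem hasDerivAt_gS (a t : ℝ) : HasDerivAt (gS a) (-(a + 1) / 3) t := by
  have h := ((((hasDerivAt_id t).div_const 3).const_sub 1).const_mul (a + 1)).sub_const (1 / 2)
  exact h.congr_deriv (by ring)

/-- `g_a` is smooth. [folklore] -/
theorem contDiff_gS (a : ℝ) {n : WithTop ℕ∞} : ContDiff ℝ n (gS a) := by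
  unfold gS
  exact (contDiff_const.mul (contDiff_const.sub (contDiff_id.div_const _))).sub contDiff_const

omit [FiniteDimensional ℝ E] [MeasurableSpace E] [BorelSpace E] in
/-- The singular piece `ρ(t, x) = -|x|²/(16t)` of `r_a` is smooth where `t ≠ 0`. [folklore] -/
theorem contDiffAt_rho {z : ℝ × E} (hz : z.1 ≠ 0) {n : WithTop ℕ∞} :
    ContDiffAt ℝ n (fun y : ℝ × E => -‖y.2‖ ^ 2 / (16 * y.1)) z :=
  (contDiff_norm_sq_snd.contDiffAt.neg).div (contDiff_const.mul contDiff_fst).contDiffAt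
    (mul_ne_zero (by norm_num) hz)

omit [FiniteDimensional ℝ E] [MeasurableSpace E] [BorelSpace E] in
/-- Derivatives of the singular piece: `Dρ(z)(s, e) = s |x|²/(16 t²) - ⟪x, e⟫/(8t)`. [folklore] -/
theorem fderiv_rho_apply {z : ℝ × E} (hz : z.1 ≠ 0) (v : ℝ × E) :
    fderiv ℝ (fun y : ℝ × E => -‖y.2‖ ^ 2 / (16 * y.1)) z v =
      v.1 * ‖z.2‖ ^ 2 / (16 * z.1 ^ 2) - ⟪z.2, v.2⟫ / (8 * z.1) := by
  -- write `ρ = ‖x‖² * k(t)` with `k(t) = -(1/16) t⁻¹`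
  set k : ℝ → ℝ := fun t => -(1 / 16) * t⁻¹ with hk
  have hkd : HasDerivAt k (-(1 / 16) * -(z.1 ^ 2)⁻¹) z.1 := (hasDerivAt_inv hz).const_mul _
  have hc := hasFDerivAt_norm_sq_snd z
  have hd : HasFDerivAt (fun y : ℝ × E => k y.1)
      (((1 : ℝ →L[ℝ] ℝ).smulRight (-(1 / 16) * -(z.1 ^ 2)⁻¹)).comp
        (ContinuousLinearMap.fst ℝ ℝ E)) z :=
    hkd.hasFDerivAt.comp z hasFDerivAt_fst
  have hρ : (fun y : ℝ × E => -‖y.2‖ ^ 2 / (16 * y.1)) = fun y => ‖y.2‖ ^ 2 * k y.1 := by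
    funext y
    simp only [hk, div_eq_mul_inv, mul_inv]
    ring
  have h2 : HasFDerivAt (fun y : ℝ × E => ‖y.2‖ ^ 2 * k y.1) _ z := hc.mul hd
  rw [hρ, h2.fderiv]
  simp only [_root_.add_apply, _root_.smul_apply, smul_eq_mul, ContinuousLinearMap.comp_apply,
    ContinuousLinearMap.smulRight_apply, one_apply_eq_self,
    ContinuousLinearMap.coe_fst', ContinuousLinearMap.coe_snd', ContinuousLinearMap.coe_id',
    id, innerSL_apply_apply, hk]
  field_simp
  ring

omit [FiniteDimensional ℝ E] [MeasurableSpace E] [BorelSpace E] in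
/-- `r_a` is smooth where `t ≠ 0`. [folklore] -/
theorem contDiffAt_rW (a : ℝ) {z : ℝ × E} (hz : z.1 ≠ 0) {n : WithTop ℕ∞} :
    ContDiffAt ℝ n (rW a : ℝ × E → ℝ) z :=
  (contDiffAt_rho hz).add ((contDiff_gS a).comp contDiff_fst).contDiffAt

omit [FiniteDimensional ℝ E] [MeasurableSpace E] [BorelSpace E] in
/-- Derivatives of `r_a`: `Dr_a(z)(s, e) = s (|x|²/(16t²) - (a+1)/3) - ⟪x, e⟫/(8t)`. [folklore] -/
theorem fderiv_rW_apply (a : ℝ) {z : ℝ × E} (hz : z.1 ≠ 0) (v : ℝ × E) :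
    fderiv ℝ (rW a : ℝ × E → ℝ) z v =
      v.1 * (‖z.2‖ ^ 2 / (16 * z.1 ^ 2) - (a + 1) / 3) - ⟪z.2, v.2⟫ / (8 * z.1) := by
  have hρ : HasFDerivAt (fun y : ℝ × E => -‖y.2‖ ^ 2 / (16 * y.1))
      (fderiv ℝ (fun y : ℝ × E => -‖y.2‖ ^ 2 / (16 * y.1)) z) z :=
    ((contDiffAt_rho hz (n := 1)).differentiableAt one_ne_zero).hasFDerivAt
  have hg : HasFDerivAt (fun y : ℝ × E => gS a y.1)
      (((1 : ℝ →L[ℝ] ℝ).smulRight (-(a + 1) / 3)).comp (ContinuousLinearMap.fst ℝ ℝ E)) z :=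
    (hasDerivAt_gS a z.1).hasFDerivAt.comp z hasFDerivAt_fst
  have h : HasFDerivAt (rW a : ℝ × E → ℝ) _ z := hρ.add hg
  rw [h.fderiv]
  simp only [_root_.add_apply, fderiv_rho_apply hz, ContinuousLinearMap.comp_apply,
    ContinuousLinearMap.smulRight_apply, one_apply_eq_self,
    ContinuousLinearMap.coe_fst', smul_eq_mul]
  ring

variable {δ a : ℝ} {V : ℝ × E → F}
variable (hδ : 0 < δ) (hV : ContDiff ℝ (⊤ : ℕ∞) V) (hVc : HasCompactSupport V)
  (hVδ : tsupport V ⊆ {z | δ ≤ z.1})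
include hδ hV hVc hVδ

/-- Integrability of weighted squares `w ‖V‖²` for weights continuous on `{t > δ/2}`. [folklore] -/
theorem integrable_mul_norm_sq {w : ℝ × E → ℝ} (hw : ContinuousOn w {z | δ / 2 < z.1}) :
    Integrable fun z => w z * ‖V z‖ ^ 2 :=
  integrable_of_continuous_hasCompactSupport
    (continuous_mul_norm_sq_of_support hδ hw hV.continuous hVδ) (hasCompactSupport_mul_norm_sq hVc)

omit hδ hVδ in
/-- Integrability of `g(t) |∇ₓV|²` for continuous `g`. [folklore] -/
theorem integrable_mul_gradSq {g : ℝ → ℝ} (hg : Continuous g) :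
    Integrable fun z => g z.1 * gradSq V z := by
  set b := stdOrthonormalBasis ℝ E
  have h : ∀ i, Integrable fun z => g z.1 * ‖dx (b i) V z‖ ^ 2 := fun i =>
    integrable_of_continuous_hasCompactSupport
      ((hg.comp continuous_fst).mul ((contDiff_dx hV _).continuous.norm.pow 2))
      (hasCompactSupport_mul_norm_sq (hasCompactSupport_dx hVc _))
  have := integrable_finsetSum Finset.univ fun i _ => h i
  refine this.congr (Eventually.of_forall fun z => ?_)
  simp only [gradSq, Finset.mul_sum]
  rfl

omit hV hVc in
/-- Integrability of weighted pairings `w ⟪X, Y⟫` of derivatives of `V` (`X`, `Y` continuous,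
`X` supported in `tsupport V`), for weights continuous on `{t > δ/2}`. [folklore] -/
theorem integrable_mul_inner {w : ℝ × E → ℝ} {X Y : ℝ × E → F}
    (hw : ContinuousOn w {z | δ / 2 < z.1}) (hX : Continuous X) (hY : Continuous Y)
    (hXc : HasCompactSupport X) (hXs : tsupport X ⊆ tsupport V) :
    Integrable fun z => w z * ⟪X z, Y z⟫ :=
  integrable_of_continuous_hasCompactSupport
    (continuous_mul_inner_of_support hδ hw hX.continuousOn hY.continuousOn fun _ hz =>
      Or.inl (eq_zero_of_lt (hXs.trans hVδ) hz))
    (hasCompactSupport_mul_inner_left hXc)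

/-- **The commutator identity** `2 ∫ ⟪S v, A v⟫ = ((a+1)/3) ∫ t |v|²` for the explicit weight
(Seregin 2014, (A.1.5)–(A.1.7): `∫ [S, A]v·v = (a+1) ∫ t²(-(h'/h)' - h'/(th)) |v|²
= ((a+1)/3) ∫ t|v|²`), proved without operator formalism: the six pairings of
`S v = tΔv + r v` with `A v = t∂ₜv + ½(x·∇)v + (½ + n/4)v` are evaluated by the identities of
`CarlemanCalculus` — `2∫ t²⟪∂ₜv, Δv⟫ = 2∫ t|∇v|²`, `∫ t⟪(x·∇)v, Δv⟫ = (n/2 - 1) ∫ t|∇v|²`,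
`2(½ + n/4) ∫ t⟪v, Δv⟫ = -(1 + n/2) ∫ t|∇v|²`, which cancel, and the square / dilation rules
for the zeroth-order terms, whose weights add up to `(a+1)t/3` — for `v` smooth, compactly
supported, supported in `{t ≥ δ}`, `δ > 0`. [cite: Seregin2014, App. A.1 (A.1.7)] -/
theorem two_mul_integral_inner_opS_opA :
    2 * ∫ z, ⟪opS a V z, opA V z⟫ = (a + 1) / 3 * ∫ z, z.1 * ‖V z‖ ^ 2 := by
  set n : ℝ := (Module.finrank ℝ E : ℝ) with hn
  set c : ℝ := 1 / 2 + n / 4 with hc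
  set U : Set (ℝ × E) := {z | δ / 2 < z.1} with hU
  have hUo : IsOpen U := isOpen_lt continuous_const continuous_fst
  have hUt : ∀ z ∈ U, z.1 ≠ 0 := fun z hz => by
    have : δ / 2 < z.1 := hz
    exact (lt_trans (by positivity) this).ne'
  have hV1 : ContDiff ℝ 1 V := hV.of_le (by exact_mod_cast le_top)
  have hV0 : ∀ z : ℝ × E, z.1 < δ → V z = 0 := fun z hz => eq_zero_of_lt hVδ hz
  have hrU : ContDiffOn ℝ 1 (rW a : ℝ × E → ℝ) U := fun z hz =>
    (contDiffAt_rW a (hUt z hz)).contDiffWithinAt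
  have crU : ContinuousOn (rW a : ℝ × E → ℝ) U := hrU.continuousOn
  -- continuity of the fields
  have cV : Continuous V := hV.continuous
  have cdt : Continuous (dt V) := (contDiff_dt hV).continuous
  have cxdx : Continuous (xdx V) := (contDiff_xdx hV).continuous
  have clap : Continuous (lap V) := (contDiff_lap hV).continuous
  -- ## (A) pointwise expansion of `⟪S v, A v⟫`
  have hexp : ∀ z, ⟪opS a V z, opA V z⟫ =
      z.1 ^ 2 * ⟪lap V z, dt V z⟫ + 1 / 2 * (z.1 * ⟪lap V z, xdx V z⟫) +
        c * (z.1 * ⟪lap V z, V z⟫) + (z.1 * rW a z) * ⟪V z, dt V z⟫ +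
        rW a z / 2 * ⟪xdx V z, V z⟫ + c * (rW a z * ‖V z‖ ^ 2) := by
    intro z
    simp only [opS, opA, inner_add_left, inner_add_right, real_inner_smul_left,
      real_inner_smul_right, real_inner_self_eq_norm_sq, real_inner_comm (xdx V z) (V z)]
    ring
  -- ## (B) integrability of the six terms
  have i1 : Integrable fun z : ℝ × E => z.1 ^ 2 * ⟪lap V z, dt V z⟫ :=
    integrable_mul_inner hδ hVδ (continuous_fst.pow 2).continuousOn clap cdt
      (hasCompactSupport_lap hVc) (tsupport_lap_subset V)
  have i2 : Integrable fun z : ℝ × E => 1 / 2 * (z.1 * ⟪lap V z, xdx V z⟫) :=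
    (integrable_mul_inner hδ hVδ continuous_fst.continuousOn clap cxdx
      (hasCompactSupport_lap hVc) (tsupport_lap_subset V)).const_mul _
  have i3 : Integrable fun z : ℝ × E => c * (z.1 * ⟪lap V z, V z⟫) :=
    (integrable_mul_inner hδ hVδ continuous_fst.continuousOn clap cV
      (hasCompactSupport_lap hVc) (tsupport_lap_subset V)).const_mul _
  have i4 : Integrable fun z : ℝ × E => (z.1 * rW a z) * ⟪V z, dt V z⟫ :=
    integrable_mul_inner hδ hVδ (continuous_fst.continuousOn.mul crU) cV cdt hVc subset_rfl
  have i5 : Integrable fun z : ℝ × E => rW a z / 2 * ⟪xdx V z, V z⟫ :=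
    integrable_mul_inner hδ hVδ (crU.div_const _) cxdx cV (hasCompactSupport_xdx hVc)
      (tsupport_xdx_subset V)
  have i6 : Integrable fun z : ℝ × E => c * (rW a z * ‖V z‖ ^ 2) :=
    (integrable_mul_norm_sq hδ hV hVc hVδ crU).const_mul _
  -- ## (C) the second-order terms
  have E1 : 2 * ∫ z : ℝ × E, z.1 ^ 2 * ⟪lap V z, dt V z⟫ = 2 * ∫ z : ℝ × E, z.1 * gradSq V z := by
    have h := integral_mul_inner_dt_lap hδ hV hVc hVδ (g := fun t => t ^ 2) (contDiff_id.pow 2)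
    have hd : ∀ t : ℝ, deriv (fun t : ℝ => t ^ 2) t = 2 * t := fun t => by
      rw [(hasDerivAt_pow 2 t).deriv]
      ring
    have e : ∫ z : ℝ × E, z.1 ^ 2 * ⟪lap V z, dt V z⟫ = ∫ z : ℝ × E, z.1 ^ 2 * ⟪dt V z, lap V z⟫ :=
      integral_congr_ae (Eventually.of_forall fun z => by
        show z.1 ^ 2 * ⟪lap V z, dt V z⟫ = z.1 ^ 2 * ⟪dt V z, lap V z⟫
        rw [real_inner_comm])
    rw [e, h]
    simp only [hd]
    rw [show (fun z : ℝ × E => 2 * z.1 * gradSq V z) = fun z => 2 * (z.1 * gradSq V z) from by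
      funext z; ring, integral_const_mul]
    ring
  have E2 : 2 * ∫ z : ℝ × E, 1 / 2 * (z.1 * ⟪lap V z, xdx V z⟫) =
      (n / 2 - 1) * ∫ z : ℝ × E, z.1 * gradSq V z := by
    have h := integral_mul_inner_xdx_lap hδ hV hVc hVδ (g := fun t => t) contDiff_id
    have e : ∫ z : ℝ × E, 1 / 2 * (z.1 * ⟪lap V z, xdx V z⟫) =
        1 / 2 * ∫ z : ℝ × E, z.1 * ⟪xdx V z, lap V z⟫ := by
      rw [← integral_const_mul]
      exact integral_congr_ae (Eventually.of_forall fun z => by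
        show 1 / 2 * (z.1 * ⟪lap V z, xdx V z⟫) = 1 / 2 * (z.1 * ⟪xdx V z, lap V z⟫)
        rw [real_inner_comm])
    rw [e, h]
    ring
  have E3 : 2 * ∫ z : ℝ × E, c * (z.1 * ⟪lap V z, V z⟫) = -(2 * c) * ∫ z : ℝ × E, z.1 * gradSq V z := by
    have h := integral_mul_inner_lap_self hδ hV hVc hVδ (g := fun t => t) contDiff_id
    have e : ∫ z : ℝ × E, c * (z.1 * ⟪lap V z, V z⟫) = c * ∫ z : ℝ × E, z.1 * ⟪V z, lap V z⟫ := by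
      rw [← integral_const_mul]
      exact integral_congr_ae (Eventually.of_forall fun z => by
        show c * (z.1 * ⟪lap V z, V z⟫) = c * (z.1 * ⟪V z, lap V z⟫)
        rw [real_inner_comm])
    rw [e, h]
    ring
  -- ## (D) the zeroth-order terms
  -- the weight `w₄ = t r` and its time derivative on `U`
  set w₄ : ℝ × E → ℝ := fun z => z.1 * rW a z with hw₄
  set W₄ : ℝ × E → ℝ := fun z => rW a z + z.1 * (‖z.2‖ ^ 2 / (16 * z.1 ^ 2) - (a + 1) / 3)
    with hW₄
  have hw₄U : ContDiffOn ℝ 1 w₄ U := contDiff_fst.contDiffOn.mul hrU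
  have hdw₄ : ∀ z ∈ U, fderiv ℝ w₄ z (1, 0) = W₄ z := by
    intro z hz
    have hrd : DifferentiableAt ℝ (rW a : ℝ × E → ℝ) z :=
      (contDiffAt_rW a (hUt z hz) (n := 1)).differentiableAt one_ne_zero
    rw [show w₄ = fun y => (fun y : ℝ × E => y.1) y * rW a y from rfl,
      fderiv_fun_mul differentiableAt_fst hrd]
    simp only [_root_.add_apply, _root_.smul_apply, smul_eq_mul, fderiv_fst_apply,
      fderiv_rW_apply a (hUt z hz)]
    simp only [hW₄, inner_zero_right]
    ring
  have E4 : 2 * ∫ z : ℝ × E, (z.1 * rW a z) * ⟪V z, dt V z⟫ = -∫ z : ℝ × E, W₄ z * ‖V z‖ ^ 2 := by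
    have h := two_mul_integral_mul_inner_fderiv_self hδ hw₄U hV1 hVc hVδ (1, 0)
    simp only [hw₄] at h
    rw [show (fun z : ℝ × E => z.1 * rW a z * ⟪V z, dt V z⟫) =
      fun z : ℝ × E => z.1 * rW a z * ⟪V z, fderiv ℝ V z (1, 0)⟫ from rfl, h]
    congr 1
    refine integral_congr_ae (Eventually.of_forall fun z => ?_)
    by_cases hz : δ / 2 < z.1
    · show fderiv ℝ (fun z : ℝ × E => z.1 * rW a z) z (1, 0) * ‖V z‖ ^ 2 = W₄ z * ‖V z‖ ^ 2
      rw [← hdw₄ z hz]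
    · have : V z = 0 := hV0 z (by linarith [not_lt.1 hz])
      simp [this]
  -- the weight `r/2` and its dilation derivative on `U`
  set W₅ : ℝ × E → ℝ := fun z => -‖z.2‖ ^ 2 / (16 * z.1) + n * (rW a z / 2) with hW₅
  have hr2U : ContDiffOn ℝ 1 (fun z : ℝ × E => rW a z / 2) U := hrU.div_const _
  have hdr2 : ∀ z ∈ U, fderiv ℝ (fun y : ℝ × E => rW a y / 2) z (0, z.2) + n * (rW a z / 2) = W₅ z := by
    intro z hz
    have hrd : DifferentiableAt ℝ (rW a : ℝ × E → ℝ) z :=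
      (contDiffAt_rW a (hUt z hz) (n := 1)).differentiableAt one_ne_zero
    rw [show (fun y : ℝ × E => rW a y / 2) = fun y => rW a y * (1 / 2) from by
      funext y; ring, fderiv_mul_const hrd]
    simp only [_root_.smul_apply, smul_eq_mul, fderiv_rW_apply a (hUt z hz),
      real_inner_self_eq_norm_sq, hW₅]
    ring
  have E5 : 2 * ∫ z : ℝ × E, rW a z / 2 * ⟪xdx V z, V z⟫ = -∫ z : ℝ × E, W₅ z * ‖V z‖ ^ 2 := by
    rw [two_mul_integral_mul_inner_xdx_self hδ hr2U hV1 hVc hVδ]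
    congr 1
    refine integral_congr_ae (Eventually.of_forall fun z => ?_)
    by_cases hz : δ / 2 < z.1
    · show (fderiv ℝ (fun y : ℝ × E => rW a y / 2) z (0, z.2) +
          Module.finrank ℝ E * (rW a z / 2)) * ‖V z‖ ^ 2 = W₅ z * ‖V z‖ ^ 2
      rw [← hdr2 z hz]
    · have : V z = 0 := hV0 z (by linarith [not_lt.1 hz])
      simp [this]
  -- ## (E) collecting the zeroth-order weights: `-W₄ - W₅ + 2c r = (a+1) t / 3`
  have cW₄ : ContinuousOn W₄ U := by
    refine crU.add (continuousOn_fst.mul ((ContinuousOn.div ?_ ?_ ?_).sub continuousOn_const))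
    · exact (continuous_snd.norm.pow 2).continuousOn
    · exact (continuous_const.mul (continuous_fst.pow 2)).continuousOn
    · exact fun z hz => mul_ne_zero (by norm_num) (pow_ne_zero _ (hUt z hz))
  have cW₅ : ContinuousOn W₅ U := by
    refine (ContinuousOn.div ?_ ?_ ?_).add (continuousOn_const.mul (crU.div_const _))
    · exact (continuous_snd.norm.pow 2).neg.continuousOn
    · exact (continuous_const.mul continuous_fst).continuousOn
    · exact fun z hz => mul_ne_zero (by norm_num) (hUt z hz)
  have j4 := integrable_mul_norm_sq hδ hV hVc hVδ cW₄
  have j5 := integrable_mul_norm_sq hδ hV hVc hVδ cW₅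
  have j6 := integrable_mul_norm_sq hδ hV hVc hVδ crU
  have jt := integrable_mul_norm_sq hδ hV hVc hVδ (w := fun z : ℝ × E => z.1)
    continuous_fst.continuousOn
  have E456 : -(∫ z : ℝ × E, W₄ z * ‖V z‖ ^ 2) - (∫ z : ℝ × E, W₅ z * ‖V z‖ ^ 2) +
      2 * c * ∫ z : ℝ × E, rW a z * ‖V z‖ ^ 2 = (a + 1) / 3 * ∫ z : ℝ × E, z.1 * ‖V z‖ ^ 2 := by
    have k4 : Integrable (fun z : ℝ × E => -(W₄ z * ‖V z‖ ^ 2)) := j4.neg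
    have k45 : Integrable (fun z : ℝ × E => -(W₄ z * ‖V z‖ ^ 2) - W₅ z * ‖V z‖ ^ 2) := k4.sub j5
    have k6 : Integrable (fun z : ℝ × E => 2 * c * (rW a z * ‖V z‖ ^ 2)) := j6.const_mul _
    have h1 : ∫ z : ℝ × E, (-(W₄ z * ‖V z‖ ^ 2) - W₅ z * ‖V z‖ ^ 2 + 2 * c * (rW a z * ‖V z‖ ^ 2)) =
        -(∫ z : ℝ × E, W₄ z * ‖V z‖ ^ 2) - (∫ z : ℝ × E, W₅ z * ‖V z‖ ^ 2) +
          2 * c * ∫ z : ℝ × E, rW a z * ‖V z‖ ^ 2 := by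
      rw [integral_add k45 k6, integral_sub k4 j5, integral_neg, integral_const_mul]
    rw [← h1, ← integral_const_mul]
    refine integral_congr_ae (Eventually.of_forall fun z => ?_)
    by_cases hz : δ / 2 < z.1
    · have ht : z.1 ≠ 0 := hUt z hz
      show -(W₄ z * ‖V z‖ ^ 2) - W₅ z * ‖V z‖ ^ 2 + 2 * c * (rW a z * ‖V z‖ ^ 2) =
        (a + 1) / 3 * (z.1 * ‖V z‖ ^ 2)
      simp only [hW₄, hW₅, hc]
      field_simp
      ring
    · have : V z = 0 := hV0 z (by linarith [not_lt.1 hz])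
      simp [this]
  -- ## (F) assembly
  have hsplit : ∫ z, ⟪opS a V z, opA V z⟫ =
      (∫ z : ℝ × E, z.1 ^ 2 * ⟪lap V z, dt V z⟫) + (∫ z : ℝ × E, 1 / 2 * (z.1 * ⟪lap V z, xdx V z⟫)) +
      (∫ z : ℝ × E, c * (z.1 * ⟪lap V z, V z⟫)) + (∫ z : ℝ × E, (z.1 * rW a z) * ⟪V z, dt V z⟫) +
      (∫ z : ℝ × E, rW a z / 2 * ⟪xdx V z, V z⟫) + ∫ z : ℝ × E, c * (rW a z * ‖V z‖ ^ 2) := by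
    have s12 : Integrable (fun z : ℝ × E => z.1 ^ 2 * ⟪lap V z, dt V z⟫ +
        1 / 2 * (z.1 * ⟪lap V z, xdx V z⟫)) := i1.add i2
    have s123 : Integrable (fun z : ℝ × E => z.1 ^ 2 * ⟪lap V z, dt V z⟫ +
        1 / 2 * (z.1 * ⟪lap V z, xdx V z⟫) + c * (z.1 * ⟪lap V z, V z⟫)) := s12.add i3
    have s1234 : Integrable (fun z : ℝ × E => z.1 ^ 2 * ⟪lap V z, dt V z⟫ +
        1 / 2 * (z.1 * ⟪lap V z, xdx V z⟫) + c * (z.1 * ⟪lap V z, V z⟫) +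
        (z.1 * rW a z) * ⟪V z, dt V z⟫) := s123.add i4
    have s12345 : Integrable (fun z : ℝ × E => z.1 ^ 2 * ⟪lap V z, dt V z⟫ +
        1 / 2 * (z.1 * ⟪lap V z, xdx V z⟫) + c * (z.1 * ⟪lap V z, V z⟫) +
        (z.1 * rW a z) * ⟪V z, dt V z⟫ + rW a z / 2 * ⟪xdx V z, V z⟫) := s1234.add i5
    rw [integral_congr_ae (Eventually.of_forall hexp), integral_add s12345 i6,
      integral_add s1234 i5, integral_add s123 i4, integral_add s12 i3, integral_add i1 i2]
  have E6 : 2 * ∫ z : ℝ × E, c * (rW a z * ‖V z‖ ^ 2) = 2 * c * ∫ z : ℝ × E, rW a z * ‖V z‖ ^ 2 := by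
    rw [integral_const_mul]
    ring
  calc 2 * ∫ z, ⟪opS a V z, opA V z⟫
      = 2 * (∫ z : ℝ × E, z.1 ^ 2 * ⟪lap V z, dt V z⟫) +
          2 * (∫ z : ℝ × E, 1 / 2 * (z.1 * ⟪lap V z, xdx V z⟫)) +
          2 * (∫ z : ℝ × E, c * (z.1 * ⟪lap V z, V z⟫)) +
          2 * (∫ z : ℝ × E, (z.1 * rW a z) * ⟪V z, dt V z⟫) +
          2 * (∫ z : ℝ × E, rW a z / 2 * ⟪xdx V z, V z⟫) +
          2 * ∫ z : ℝ × E, c * (rW a z * ‖V z‖ ^ 2) := by rw [hsplit]; ring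
    _ = (2 + (n / 2 - 1) - 2 * c) * (∫ z : ℝ × E, z.1 * gradSq V z) +
          (-(∫ z : ℝ × E, W₄ z * ‖V z‖ ^ 2) - (∫ z : ℝ × E, W₅ z * ‖V z‖ ^ 2) +
            2 * c * ∫ z : ℝ × E, rW a z * ‖V z‖ ^ 2) := by
        rw [E1, E2, E3, E4, E5, E6]; ring
    _ = (a + 1) / 3 * ∫ z : ℝ × E, z.1 * ‖V z‖ ^ 2 := by
        rw [E456, hc]; ring

omit [MeasurableSpace E] [BorelSpace E] hδ hV hVc hVδ in
/-- Off the support of `v` the operator `P v` vanishes (all derivatives of `v` vanish there). [folklore] -/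
theorem opP_eq_zero_of_notMem_tsupport {z : ℝ × E} (hz : z ∉ tsupport V) : opP a V z = 0 := by
  have h0 : V z = 0 := image_eq_zero_of_notMem_tsupport hz
  have h1 : fderiv ℝ V z = 0 := fderiv_of_notMem_tsupport (𝕜 := ℝ) hz
  have h2 : lap V z = 0 :=
    image_eq_zero_of_notMem_tsupport fun h => hz (tsupport_lap_subset V h)
  simp [opP, opS, opA, dt, xdx, h0, h1, h2]

omit [MeasurableSpace E] [BorelSpace E] hVc in
/-- `S v` is continuous (it vanishes for `t < δ` and is continuous on `{t > δ/2}`). [folklore] -/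
theorem continuous_opS : Continuous (opS a V) := by
  have hUt : ∀ z : ℝ × E, δ / 2 < z.1 → z.1 ≠ 0 := fun z hz => (lt_trans (by positivity) hz).ne'
  have crU : ContinuousOn (rW a : ℝ × E → ℝ) {z | δ / 2 < z.1} := fun z hz =>
    (contDiffAt_rW a (hUt z hz) (n := 0)).continuousAt.continuousWithinAt
  refine continuous_of_zero_of_lt hδ ?_ fun z hz => ?_
  · exact (continuousOn_fst.smul (contDiff_lap hV).continuous.continuousOn).add
      (crU.smul hV.continuous.continuousOn)
  · have h0 : V z = 0 := eq_zero_of_lt hVδ hz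
    have h2 : lap V z = 0 := eq_zero_of_lt ((tsupport_lap_subset V).trans hVδ) hz
    simp [opS, h0, h2]

omit [FiniteDimensional ℝ E] [MeasurableSpace E] [BorelSpace E] hδ hVc hVδ in
/-- `A v` is continuous. [folklore] -/
theorem continuous_opA : Continuous (opA V) :=
  ((continuous_fst.smul (contDiff_dt hV).continuous).add
    (continuous_const.smul (contDiff_xdx hV).continuous)).add (continuous_const.smul hV.continuous)

omit [MeasurableSpace E] [BorelSpace E] hδ hV hVδ in
/-- `S v` is compactly supported. [folklore] -/
theorem hasCompactSupport_opS : HasCompactSupport (opS a V) := by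
  refine hVc.mono' fun z hz => ?_
  contrapose! hz
  have h0 : V z = 0 := image_eq_zero_of_notMem_tsupport hz
  have h2 : lap V z = 0 := image_eq_zero_of_notMem_tsupport fun h => hz (tsupport_lap_subset V h)
  simp [opS, h0, h2]

omit [FiniteDimensional ℝ E] [MeasurableSpace E] [BorelSpace E] hδ hV hVδ in
/-- `A v` is compactly supported. [folklore] -/
theorem hasCompactSupport_opA : HasCompactSupport (opA V) := by
  refine hVc.mono' fun z hz => ?_
  contrapose! hz
  have h0 : V z = 0 := image_eq_zero_of_notMem_tsupport hz
  have h1 : fderiv ℝ V z = 0 := fderiv_of_notMem_tsupport (𝕜 := ℝ) hz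
  simp [opA, dt, xdx, h0, h1]

/-- `⟪S v, A v⟫` is integrable. [folklore] -/
theorem integrable_inner_opS_opA : Integrable fun z => ⟪opS a V z, opA V z⟫ :=
  integrable_of_continuous_hasCompactSupport
    ((continuous_opS hδ hV hVδ).inner (continuous_opA hV))
    ((hasCompactSupport_mul_inner_left (w := fun _ => (1 : ℝ)) (X := opA V)
      (hasCompactSupport_opS hVc (a := a))).mono fun z hz => by simpa using hz)

/-- `|P v|²` is integrable. [folklore] -/
theorem integrable_norm_sq_opP : Integrable fun z => ‖opP a V z‖ ^ 2 := by
  have cP : Continuous (opP a V) := (continuous_opS hδ hV hVδ).add (continuous_opA hV)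
  have hPc : HasCompactSupport (opP a V) := (hasCompactSupport_opS hVc).add (hasCompactSupport_opA hVc)
  have h := integrable_of_continuous_hasCompactSupport (cP.norm.mul cP.norm)
    (hPc.norm.mul_right (f' := fun z => ‖opP a V z‖))
  refine h.congr (Eventually.of_forall fun z => ?_)
  show ‖opP a V z‖ * ‖opP a V z‖ = ‖opP a V z‖ ^ 2
  rw [sq]

/-- Weighted pairings `w ⟪v, P v⟫` are integrable for weights continuous on `{t > δ/2}`. [folklore] -/
theorem integrable_mul_inner_opP {w : ℝ × E → ℝ} (hw : ContinuousOn w {z | δ / 2 < z.1}) :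
    Integrable fun z => w z * ⟪V z, opP a V z⟫ :=
  integrable_mul_inner hδ hVδ hw hV.continuous
    ((continuous_opS hδ hV hVδ).add (continuous_opA hV)) hVc subset_rfl

/-- **`(a+1) ∫ t|v|² ≤ 3 ∫ |P v|²`** (Seregin 2014, (A.1.5) with (A.1.7):
`∫ t²|Lv|² = ∫ |Sv|² + ∫ |Av|² + ∫ [S,A]v·v ≥ I = ((a+1)/3) ∫ t|v|²`). [cite: Seregin2014, App. A.1 (A.1.5)–(A.1.7)] -/
theorem integral_mul_norm_sq_le_three_mul :
    (a + 1) * ∫ z, z.1 * ‖V z‖ ^ 2 ≤ 3 * ∫ z, ‖opP a V z‖ ^ 2 := by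
  have hI := two_mul_integral_inner_opS_opA hδ hV hVc hVδ (a := a)
  have iSA := integrable_inner_opS_opA hδ hV hVc hVδ (a := a)
  have iP := integrable_norm_sq_opP hδ hV hVc hVδ (a := a)
  -- pointwise `2⟪S v, A v⟫ ≤ ‖S v + A v‖²`, integrated
  have hpt : ∀ z, 2 * ⟪opS a V z, opA V z⟫ ≤ ‖opP a V z‖ ^ 2 := fun z => by
    have h := norm_add_sq_real (opS a V z) (opA V z)
    have e : opP a V z = opS a V z + opA V z := rfl
    rw [e, h]
    nlinarith [sq_nonneg ‖opS a V z‖, sq_nonneg ‖opA V z‖]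
  have hmono : ∫ z, 2 * ⟪opS a V z, opA V z⟫ ≤ ∫ z, ‖opP a V z‖ ^ 2 :=
    integral_mono (iSA.const_mul 2) iP hpt
  rw [integral_const_mul] at hmono
  linarith

/-- **The pairing `∫ t⟪v, P v⟫`** (Seregin 2014, (A.1.8)–(A.1.9) in the form
`∫ t² v·Lv = -∫ t²|∇v|² + ∫ t r |v|² - ½ ∫ t|v|²`, i.e. (A.1.9) with `t²(|∇φ|² - ∂ₜφ) = t r + t/2`):
from `⟪v, P v⟫ = t⟪v, Δv⟫ + r|v|² + t⟪v, ∂ₜv⟫ + ½⟪v, (x·∇)v⟫ + (½ + n/4)|v|²` and the evaluations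
`∫ t²⟪v, Δv⟫ = -∫ t²|∇v|²`, `∫ t²⟪v, ∂ₜv⟫ = -∫ t|v|²`, `∫ t⟪(x·∇)v, v⟫ = -(n/2) ∫ t|v|²`. [cite: Seregin2014, App. A.1 (A.1.9)] -/
theorem integral_mul_inner_opP :
    ∫ z, z.1 * ⟪V z, opP a V z⟫ =
      -(∫ z, z.1 ^ 2 * gradSq V z) + (∫ z, (z.1 * rW a z) * ‖V z‖ ^ 2) -
        1 / 2 * ∫ z, z.1 * ‖V z‖ ^ 2 := by
  set n : ℝ := (Module.finrank ℝ E : ℝ) with hn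
  set c : ℝ := 1 / 2 + n / 4 with hc
  set U : Set (ℝ × E) := {z | δ / 2 < z.1} with hU
  have hUt : ∀ z ∈ U, z.1 ≠ 0 := fun z hz => by
    have : δ / 2 < z.1 := hz
    exact (lt_trans (by positivity) this).ne'
  have hV1 : ContDiff ℝ 1 V := hV.of_le (by exact_mod_cast le_top)
  have crU : ContinuousOn (rW a : ℝ × E → ℝ) U := fun z hz =>
    (contDiffAt_rW a (hUt z hz) (n := 0)).continuousAt.continuousWithinAt
  have cV : Continuous V := hV.continuous
  have cdt : Continuous (dt V) := (contDiff_dt hV).continuous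
  have cxdx : Continuous (xdx V) := (contDiff_xdx hV).continuous
  have clap : Continuous (lap V) := (contDiff_lap hV).continuous
  -- pointwise expansion
  have hexp : ∀ z, z.1 * ⟪V z, opP a V z⟫ =
      z.1 ^ 2 * ⟪V z, lap V z⟫ + (z.1 * rW a z) * ‖V z‖ ^ 2 + z.1 ^ 2 * ⟪V z, dt V z⟫ +
        1 / 2 * (z.1 * ⟪xdx V z, V z⟫) + c * (z.1 * ‖V z‖ ^ 2) := by
    intro z
    simp only [opP, opS, opA, inner_add_right, real_inner_smul_right,
      real_inner_self_eq_norm_sq, real_inner_comm (xdx V z) (V z)]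
    ring
  -- integrability
  have i1 : Integrable fun z : ℝ × E => z.1 ^ 2 * ⟪V z, lap V z⟫ :=
    integrable_mul_inner hδ hVδ (continuous_fst.pow 2).continuousOn cV clap hVc subset_rfl
  have i2 : Integrable fun z : ℝ × E => (z.1 * rW a z) * ‖V z‖ ^ 2 :=
    integrable_mul_norm_sq hδ hV hVc hVδ (continuousOn_fst.mul crU)
  have i3 : Integrable fun z : ℝ × E => z.1 ^ 2 * ⟪V z, dt V z⟫ :=
    integrable_mul_inner hδ hVδ (continuous_fst.pow 2).continuousOn cV cdt hVc subset_rfl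
  have i4 : Integrable fun z : ℝ × E => 1 / 2 * (z.1 * ⟪xdx V z, V z⟫) :=
    (integrable_mul_inner hδ hVδ continuous_fst.continuousOn cxdx cV (hasCompactSupport_xdx hVc)
      (tsupport_xdx_subset V)).const_mul _
  have i5 : Integrable fun z : ℝ × E => c * (z.1 * ‖V z‖ ^ 2) :=
    (integrable_mul_norm_sq hδ hV hVc hVδ continuous_fst.continuousOn).const_mul _
  -- evaluations
  have E1 : ∫ z : ℝ × E, z.1 ^ 2 * ⟪V z, lap V z⟫ = -∫ z : ℝ × E, z.1 ^ 2 * gradSq V z :=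
    integral_mul_inner_lap_self hδ hV hVc hVδ (g := fun t => t ^ 2) (contDiff_id.pow 2)
  have E3 : ∫ z : ℝ × E, z.1 ^ 2 * ⟪V z, dt V z⟫ = -∫ z : ℝ × E, z.1 * ‖V z‖ ^ 2 := by
    have h := two_mul_integral_mul_inner_dt_self hδ (g := fun t => t ^ 2) (contDiff_id.pow 2)
      hV1 hVc hVδ
    have hd : ∀ t : ℝ, deriv (fun t : ℝ => t ^ 2) t = 2 * t := fun t => by
      rw [(hasDerivAt_pow 2 t).deriv]
      ring
    simp only [hd] at h
    rw [show (fun z : ℝ × E => 2 * z.1 * ‖V z‖ ^ 2) = fun z => 2 * (z.1 * ‖V z‖ ^ 2) from by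
      funext z; ring, integral_const_mul] at h
    linarith
  have E4 : ∫ z : ℝ × E, 1 / 2 * (z.1 * ⟪xdx V z, V z⟫) = -(n / 4) * ∫ z : ℝ × E, z.1 * ‖V z‖ ^ 2 := by
    have h := two_mul_integral_mul_inner_xdx_self' hδ (g := fun t => t) contDiff_id hV1 hVc hVδ
    rw [integral_const_mul]
    linarith
  have E5 : ∫ z : ℝ × E, c * (z.1 * ‖V z‖ ^ 2) = c * ∫ z : ℝ × E, z.1 * ‖V z‖ ^ 2 :=
    integral_const_mul _ _
  -- assembly
  have s12 : Integrable (fun z : ℝ × E => z.1 ^ 2 * ⟪V z, lap V z⟫ + (z.1 * rW a z) * ‖V z‖ ^ 2) :=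
    i1.add i2
  have s123 : Integrable (fun z : ℝ × E => z.1 ^ 2 * ⟪V z, lap V z⟫ + (z.1 * rW a z) * ‖V z‖ ^ 2 +
      z.1 ^ 2 * ⟪V z, dt V z⟫) := s12.add i3
  have s1234 : Integrable (fun z : ℝ × E => z.1 ^ 2 * ⟪V z, lap V z⟫ + (z.1 * rW a z) * ‖V z‖ ^ 2 +
      z.1 ^ 2 * ⟪V z, dt V z⟫ + 1 / 2 * (z.1 * ⟪xdx V z, V z⟫)) := s123.add i4
  rw [integral_congr_ae (Eventually.of_forall hexp), integral_add s1234 i5, integral_add s123 i4,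
    integral_add s12 i3, integral_add i1 i2, E1, E3, E4, E5, hc]
  ring

/-- **`∫ t²|∇v|² + ∫ (|x|²/16)|v|² ≤ 4 ∫ |P v|²`** for `a + 1 ≥ 0` and `v` supported in
`{δ ≤ t ≤ 2}` (Seregin 2014, (A.1.10): `∫ t²(|∇v|² + |v|²|∇φ|²) ≤ 3I - ∫ t² v·Lv ≤ b₁ ∫ t²|Lv|²`,
here with `t²|∇φ|² = |x|²/16` and `b₁ = 4`: `t g(t) ≤ (a + ½) t`, Cauchy–Schwarz with `t ≤ 2`, and
`(a+1) ∫ t|v|² ≤ 3 ∫ |P v|²`). [cite: Seregin2014, App. A.1 (A.1.10)] -/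
theorem integral_gradSq_add_le_four_mul (ha : 0 ≤ a + 1) (hV2 : tsupport V ⊆ {z | z.1 ≤ 2}) :
    (∫ z, z.1 ^ 2 * gradSq V z) + (∫ z, ‖z.2‖ ^ 2 / 16 * ‖V z‖ ^ 2) ≤
      4 * ∫ z, ‖opP a V z‖ ^ 2 := by
  set U : Set (ℝ × E) := {z | δ / 2 < z.1} with hU
  have hUt : ∀ z ∈ U, z.1 ≠ 0 := fun z hz => by
    have : δ / 2 < z.1 := hz
    exact (lt_trans (by positivity) this).ne'
  have hV0 : ∀ z : ℝ × E, z.1 < δ → V z = 0 := fun z hz => eq_zero_of_lt hVδ hz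
  have crU : ContinuousOn (rW a : ℝ × E → ℝ) U := fun z hz =>
    (contDiffAt_rW a (hUt z hz) (n := 0)).continuousAt.continuousWithinAt
  have hR1 := integral_mul_norm_sq_le_three_mul hδ hV hVc hVδ (a := a)
  have hII := integral_mul_inner_opP hδ hV hVc hVδ (a := a)
  -- `∫ t r |v|² = -∫ (|x|²/16)|v|² + ∫ t g(t) |v|²`
  have jx := integrable_mul_norm_sq hδ hV hVc hVδ (w := fun z : ℝ × E => ‖z.2‖ ^ 2 / 16)
    ((continuous_snd.norm.pow 2).div_const _).continuousOn
  have jg := integrable_mul_norm_sq hδ hV hVc hVδ (w := fun z : ℝ × E => z.1 * gS a z.1)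
    (continuous_fst.mul ((contDiff_gS a (n := 0)).continuous.comp continuous_fst)).continuousOn
  have jt := integrable_mul_norm_sq hδ hV hVc hVδ (w := fun z : ℝ × E => z.1)
    continuous_fst.continuousOn
  have htr : ∫ z : ℝ × E, (z.1 * rW a z) * ‖V z‖ ^ 2 =
      -(∫ z : ℝ × E, ‖z.2‖ ^ 2 / 16 * ‖V z‖ ^ 2) + ∫ z : ℝ × E, (z.1 * gS a z.1) * ‖V z‖ ^ 2 := by
    have k : Integrable (fun z : ℝ × E => -(‖z.2‖ ^ 2 / 16 * ‖V z‖ ^ 2)) := jx.neg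
    rw [← integral_neg, ← integral_add k jg]
    refine integral_congr_ae (Eventually.of_forall fun z => ?_)
    by_cases hz : δ / 2 < z.1
    · have ht : z.1 ≠ 0 := hUt z hz
      show z.1 * rW a z * ‖V z‖ ^ 2 = -(‖z.2‖ ^ 2 / 16 * ‖V z‖ ^ 2) + z.1 * gS a z.1 * ‖V z‖ ^ 2
      simp only [rW]
      field_simp
    · have : V z = 0 := hV0 z (by linarith [not_lt.1 hz])
      simp [this]
  -- `∫ t g(t) |v|² ≤ (a + ½) ∫ t |v|²`
  have hb1 : ∫ z : ℝ × E, (z.1 * gS a z.1) * ‖V z‖ ^ 2 ≤ (a + 1 / 2) * ∫ z : ℝ × E, z.1 * ‖V z‖ ^ 2 := by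
    rw [← integral_const_mul]
    refine integral_mono jg (jt.const_mul _) fun z => ?_
    show z.1 * gS a z.1 * ‖V z‖ ^ 2 ≤ (a + 1 / 2) * (z.1 * ‖V z‖ ^ 2)
    have h : z.1 * gS a z.1 ≤ (a + 1 / 2) * z.1 := by
      simp only [gS]
      nlinarith [sq_nonneg z.1, ha]
    nlinarith [sq_nonneg ‖V z‖, h]
  -- `-∫ t⟪v, Pv⟫ ≤ ½ ∫ t|v|² + ∫ |Pv|²`
  have iP := integrable_norm_sq_opP hδ hV hVc hVδ (a := a)
  have itP := integrable_mul_inner_opP hδ hV hVc hVδ (a := a) (w := fun z : ℝ × E => -z.1)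
    continuous_fst.neg.continuousOn
  have hb2 : -(∫ z : ℝ × E, z.1 * ⟪V z, opP a V z⟫) ≤
      1 / 2 * (∫ z : ℝ × E, z.1 * ‖V z‖ ^ 2) + ∫ z : ℝ × E, ‖opP a V z‖ ^ 2 := by
    rw [← integral_neg, ← integral_const_mul, ← integral_add (jt.const_mul _) iP]
    have itP' : Integrable (fun z : ℝ × E => -(z.1 * ⟪V z, opP a V z⟫)) :=
      itP.congr (Eventually.of_forall fun z => by simp)
    refine integral_mono itP' ((jt.const_mul _).add iP) fun z => ?_
    show -(z.1 * ⟪V z, opP a V z⟫) ≤ 1 / 2 * (z.1 * ‖V z‖ ^ 2) + ‖opP a V z‖ ^ 2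
    by_cases hz : z ∈ tsupport V
    · have ht0 : δ ≤ z.1 := hVδ hz
      have ht2 : z.1 ≤ 2 := hV2 hz
      have hcs := abs_real_inner_le_norm (V z) (opP a V z)
      have hab := neg_abs_le ⟪V z, opP a V z⟫
      nlinarith [mul_self_nonneg (‖V z‖ - ‖opP a V z‖), norm_nonneg (V z),
        norm_nonneg (opP a V z), hδ, abs_nonneg ⟪V z, opP a V z⟫]
    · have h0 : V z = 0 := image_eq_zero_of_notMem_tsupport hz
      have hP : opP a V z = 0 := opP_eq_zero_of_notMem_tsupport hz
      simp [h0, hP]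
  -- `0 ≤ ∫ t|v|²`
  have hpos : 0 ≤ ∫ z : ℝ × E, z.1 * ‖V z‖ ^ 2 := by
    refine integral_nonneg fun z => ?_
    by_cases hz : z ∈ tsupport V
    · have ht0 : δ ≤ z.1 := hVδ hz
      exact mul_nonneg (by linarith) (sq_nonneg _)
    · have h0 : V z = 0 := image_eq_zero_of_notMem_tsupport hz
      simp [h0]
  linarith [hII, htr, hb1, hb2, hpos, hR1]

end Core

/-! ### The Carleman weights of Prop. 1.2 (Seregin 2014, (A.1.1)) -/

section Weights

variable {E : Type*} [NormedAddCommGroup E]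

/-- The function `h(t) = t e^{(1-t)/3}` of Seregin 2014, Prop. 1.2. [cite: Seregin2014, App. A.1 Prop. 1.2] -/
def hW (t : ℝ) : ℝ :=
  t * Real.exp ((1 - t) / 3)

/-- The Carleman weight `h(t)^{-2a} e^{-|x|²/(4t)}` of (A.1.1) (time first: `z = (t, x)`). [cite: Seregin2014, App. A.1 (A.1.1)] -/
def carlemanWeight (a : ℝ) (z : ℝ × E) : ℝ :=
  hW z.1 ^ (-(2 * a)) * Real.exp (-‖z.2‖ ^ 2 / (4 * z.1))

/-- The exponent `φ(x, t) = -|x|²/(8t) - (a+1) log h(t)` of the conjugation `v = e^φ u`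
(Seregin 2014, proof of Prop. 1.2). [cite: Seregin2014, App. A.1, proof of Prop. 1.2] -/
def phiW (a : ℝ) (z : ℝ × E) : ℝ :=
  -‖z.2‖ ^ 2 / (8 * z.1) - (a + 1) * Real.log (hW z.1)

/-- `h(t) > 0` for `t > 0`. [folklore] -/
theorem hW_pos {t : ℝ} (ht : 0 < t) : 0 < hW t :=
  mul_pos ht (Real.exp_pos _)

/-- The weight is positive for `t > 0`. [folklore] -/
theorem carlemanWeight_pos (a : ℝ) {z : ℝ × E} (hz : 0 < z.1) : 0 < carlemanWeight a z :=
  mul_pos (Real.rpow_pos_of_pos (hW_pos hz) _) (Real.exp_pos _)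

/-- **`t² e^{2φ} = h^{-2a} e^{-|x|²/(4t)} · (t/h)²`**, i.e. `t² e^{2φ(t,x)} = e^{-2(1-t)/3} w_a(t, x)`
for `t > 0` (Seregin 2014, last step of the proof of Prop. 1.2). [cite: Seregin2014, App. A.1, proof of Prop. 1.2] -/
theorem sq_mul_exp_two_mul_phiW (a : ℝ) {z : ℝ × E} (hz : 0 < z.1) :
    z.1 ^ 2 * Real.exp (2 * phiW a z) = Real.exp (-(2 * (1 - z.1) / 3)) * carlemanWeight a z := by
  set η : ℝ := z.1 * Real.exp ((1 - z.1) / 3) with hη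
  have hh : 0 < η := mul_pos hz (Real.exp_pos _)
  simp only [phiW, carlemanWeight, hW, ← hη]
  rw [show 2 * (-‖z.2‖ ^ 2 / (8 * z.1) - (a + 1) * Real.log η) =
      -‖z.2‖ ^ 2 / (4 * z.1) + Real.log η * (-(2 * (a + 1))) from by field_simp; ring]
  rw [Real.exp_add, ← Real.rpow_def_of_pos hh,
    show (-(2 * (a + 1)) : ℝ) = -(2 * a) + (-2 : ℝ) from by ring,
    Real.rpow_add hh, Real.rpow_neg hh.le 2, Real.rpow_two]
  -- `η² = t² e^{2(1-t)/3}`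
  have e3 : η ^ 2 = z.1 ^ 2 * Real.exp (2 * (1 - z.1) / 3) := by
    rw [hη, mul_pow, ← Real.exp_nat_mul]
    congr 2
    push_cast
    ring
  rw [e3, Real.exp_neg]
  have ht2 : z.1 ^ 2 ≠ 0 := pow_ne_zero _ hz.ne'
  have hexp : Real.exp (2 * (1 - z.1) / 3) ≠ 0 := (Real.exp_pos _).ne'
  field_simp

end Weights

end Carleman

end Literature.Analysis.FluidPDE
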